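import Summits.QuantumFields.BalabanUV.Beta.GAN24.CoDressedColumnPairing
import Summits.QuantumFields.BalabanUV.Beta.GAN24.DressedLegEnvelope
import Summits.QuantumFields.BalabanUV.Beta.FP.CompositeMinimiserDecay
import Summits.QuantumFields.BalabanUV.Beta.RelInvBorderedHessian

/-!
# `BalabanUV.Beta.D1BFx.PackedColumnEnvelope` — road «BF-x» for binder row D1, slot (K), DICT-CHAIN-SPEC §2 (II): **«G0-COL-ENV» — THE n-EXPLICIT
# ENVELOPE OF THE ROAD's M-SIDE PACKED WEIGHTS `colH G₀ n` (`G₀ := coDressKBmAt (toSite r) n (KInvStep 3 n 0)`, the comb∕block-mean-GAUGED one-shot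
# resolvent): `|colH G₀ n μ y κ u| ≤ n⁻⁴ · C · e^{−(κ′∕(4n))·|u − n•y|₁}`, UNCONDITIONAL — the column-side Π_bm-dressing costs ONE power of `n` over the
# undressed minimiser column `wH^{(n)}` (`n⁻⁵`, `FP.CompositeMinimiserDecay.abs_wH_le`), not the `(2n+1)⁴`-window of the stencil-side constant `cKb′`**

HONEST DEPENDENCY (cell records, verbatim): «continuum YM on T⁴ ⇐ BetaPertH ∧ nine spine estimates (0/9 proved); BetaPertH ⇐ (D1) ∧ (D4) ∧
CAP+tail; G-an2-4 gates asym, D1 and NE2/3/4.»  HONEST FRAMING (cell contract, verbatim): «discharging `BetaPertH` makes Bałaban's UV stability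
UNCONDITIONAL — a real constructive-QFT result; it is NOT the continuum limit and NOT the Clay problem.»  THIS MODULE DISCHARGES NOTHING of the
wall: [folklore] composition BY NAME of LANDED theorems — gan24-leaf-02's «the co-dressed column is the undressed one minus an exact gradient of its
block-mean tree gauge» (`GAN24.CoDressedColumnPairing.colH_coDressKBmAt_eq_sub_grad`), gan24-leaf-01's blockwise sup form of the rooted gauge
(`GAN24.DressedLegEnvelope.abs_bmGaugeAt_le_of_blockwise`), gan24-leaf-12's envelope wobble ∕ `ℓ¹` majorant (`GAN24.EnvelopeBlockSum.env_wobble` ∕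
`env_le_exp_l1`), d1-formalise-leaf-05's UNCONDITIONAL minimiser-column bound (`FP.CompositeMinimiserDecay.abs_wH_le`: `|wH κ l (z − N•q)| ≤
N^{−(d+2)}·MG163(d+1)·periodConst(κ₁₆₃(d+1), d)·e^{−(κ₁₆₃(d+1)∕(d+1))‖⌊z∕N⌋ − q‖∞}`, d-only constants, NO printed hypothesis), an2's
`BorderedHessian.KInvStep_zero_eq` and an4's read-out `OneStepResolventKernel.KInv_inl_inr_coarse`.  No definition, no `def … : Prop`, nothing
cited, 0 sorry.  It is a WEIGHT LETTER, not a unit row: NO (1.22) count of any rest word is proved here.  0 root-level binders of row D1 discharged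
(hW ∕ hR-sockets ∕ hSX-socket ∕ D1Tel ∕ D1Rep = 0); (K) NOT closed; NOT D1, NOT `BetaPertH`, NOT continuum, NOT Clay.

ABSOLUTE RULE (cell charter, verbatim): «No internally-minted statement may enter as a cited fact. Every hypothesis is either kernel-proved in
this package or a verbatim quotation of a PUBLISHED theorem with page reference. The manuscript(s) under audit are NOT citable for their own
disputed steps — they are the thing under adjudication; programme-internal (2001/route/tribunal) claims are never citable.»

WHY (the OWNER d1-p2 g18's PART 7∕8 `PackedRoadHptwGhost` ∕ `PackedRoadK6cSkeleton` p323742 ∕ p324577 ✓; `CENSUS-K6a-v1.md` §v4.29 «the Πᵀ_bm dressing's `ℓ¹`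
cost … the crude `locStencil_coProjBmAtK` constant `cKb′ 3 n δ = cWb 3 n·e^{8δn}` would cost `~n⁵` if used as a mass letter»; d1-leaf-04 g19's CLOSING
«OPEN: the n-uniform window bookkeeping of the (II) rows at the DRESSED packs»).  EVERY M-side rest word of the road's (K) identity is packed with the
SAME weights `colH G₀ (m+1)`: the comb-FP families `𝒳 ∕ 𝒳₂` of RK-FP (`2·hessKer idK1 𝒳 𝒳₂`), the gauged ghost currents `𝒢 ∕ 𝒟` of the sixteen-word
bracket `R₁₆` and of (J3)'s left side, and the jets `vertexOfK G₀ (m+1) (SN m a S)` inside `legCross ∕ blockTerms`.  Their (1.22) unit counts need ONE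
letter: the power of `n` in the envelope of `colH G₀ (m+1) μ y κ u` as a function of the fine bond `(κ, u)` around the coarse bond `(μ, y)`.  Moving the
dressing onto the STENCILS (`PackedDressingBridge`: `vertexOfK G₀ = vertexOfK K (coProjBmAtK ρ n S)`) meets the `(2n+1)⁴`-window constant `cWb`; moving it
onto the COLUMN meets only the rooted tree gauge of the column, which reads `≤ (d+1)·n` letters of the column INSIDE ONE BLOCK, on which the
minimiser's block-scale envelope is CONSTANT ⇒ the dressed column keeps the envelope with the factor `1 + 2(d+1)n(1 + e^{c})` — ONE power of `n`.

CONTENT.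
* §1 [folklore, generic `d`, ANY packed kernel `K`] **`abs_colH_coDressKBmAt_le_of_blockEnvelope`**: a block-scale column envelope
  `|colH K N μ y κ u| ≤ M·e^{−c‖⌊u∕N⌋ − y‖∞}` (`M, c ≥ 0`) gives `|colH (coDressKBmAt (toSite r) N K) N μ y κ u| ≤ M·(1 + 2(d+1)N(1 + e^{c}))·e^{−c‖⌊u∕N⌋ − y‖∞}`
  for every in-block root `r` (`1 ≤ N`).
* §2 [folklore, generic `d`, the ONE-SHOT resolvent `KInvStep d N 0 = KInv N`] `abs_colH_KInvStep_zero_le` (the undressed column IS `wH^{(N)}`: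
  `≤ N^{−(d+2)}·C_d·e^{−c_d‖⌊u∕N⌋ − y‖∞}`, `C_d := MG163(d+1)·periodConst(κ₁₆₃(d+1), d)`, `c_d := κ₁₆₃(d+1)∕(d+1)`), **`abs_colH_G0_le_block`**
  (dressed: `≤ N^{−(d+2)}·C_d·(1 + 2(d+1)N(1 + e^{c_d}))·e^{−c_d‖⌊u∕N⌋ − y‖∞}`), **`abs_colH_G0_le_block'`** (the power displayed:
  `≤ N^{−(d+1)}·C_d·(1 + 2(d+1)(1 + e^{c_d}))·e^{−c_d‖⌊u∕N⌋ − y‖∞}`), **`abs_colH_G0_le_l1`** (fine `ℓ¹` currency: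
  `≤ N^{−(d+1)}·C_d·(1 + 2(d+1)(1 + e^{c_d}))·e^{c_d}·e^{−(c_d∕((d+1)N))·|u − N•y|₁}`).
* §3 [folklore, `d = 3`, `n = m + 1`, the road's names] **`abs_colH_G₀_road_le`**: for every in-block root `r ∈ box 4 n` and every `μ y κ`,
  `∀ u, |colH (coDressKBmAt (toSite r) n (KInvStep 3 n 0)) n μ y κ u| ≤ (n⁴)⁻¹·(C₄·(1 + 8(1 + e^{κ′}))·e^{κ′})·e^{−(κ′∕(4n))·|u − n•y|₁}` with
  `C₄ := MG163 4·periodConst (kappa163 4) 3`, `κ′ := kappa163 4 ∕ 4` — EXACTLY the weight shape `hw` of `OneStepResolventKernel.biLoc_wsum` ∕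
  `PeriodicArrayWrapColH.colH_weight` ∕ the jets' mass letters, with the SAME `C₄, κ′` as leaf-01's N-leg letters `RestLegEnvelopes.decays_blk_NlegRoad_fm`
  (there `n⁻⁵`: the N-leg's fm block is the UNDRESSED `wH^{(n)}`); `colH_G₀_road_weight_nonneg`.  LOCATED COUNT: the road's M-side packed weights are
  `n⁻⁴ = n^{−(d+1)}`, one power above the undressed `n⁻⁵`, decaying on the block scale; unconditional.
NOT HERE (honest): any (1.22) unit row (RK-FP is d1-leaf-04's, first refusal W-d1p2-g18-14; the gauged ghost words wait for an2's Q-GH-W′ ruling); any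
sharper count of the gauged column (whether the true power is `n⁻⁵` is an an5-class question, not needed at this currency); anything about Bałaban's tables.
Unit `b2b-balaban-gan24-formalise-leaf-05` (gen 53), G-an2-4 swarm leaf prover 05, road «BF-x» supplier (WRAP ∕ `colH`-weights lineage:
`PeriodicArrayWrapColH` p317988, `PeriodicArrayWrapNamed` p320856, `GhostSqrtLegPacked` p322060); INTENT «G0-COL-ENV» (journal).
-/

noncomputable section

open Finset
open scoped BigOperators
open Literature.MathematicalPhysics.QuantumFieldTheory
open Literature.MathematicalPhysics.QuantumFieldTheory.LatticeForm (quo)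
open Literature.MathematicalPhysics.QuantumFieldTheory.Balaban1983to89
open Literature.MathematicalPhysics.QuantumFieldTheory.Balaban1983to89.Beta
open B12Sec2to5 (l1 l1_nonneg)
open B4ContourShift (supNorm supNorm_nonneg)
open B5Hk163Strip (kappa163 kappa163_pos)
open B5Hk163Decay (MG163)
open B4TorusKernel (periodConst)
open ExpKernelCalculus (MKer)
open AffineAveraging (Form1 box toSite unitVec)
open AveragingContours (blk)
open KernelSpecInstance (wH)
open OneStepResolventKernel (Fib KInv KInv_inl_inr_coarse)
open OneStepKernelFamily (colH KInvStep)
open Summit.QuantumFields.BalabanUV.Beta.AxialProjectorBlockMean (bmGaugeAt)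
open Summit.QuantumFields.BalabanUV.Beta.AxialDressingRooted (coDressKBmAt)
open Summit.QuantumFields.BalabanUV.Beta.BorderedHessian (KInvStep_zero_eq)
open Summit.QuantumFields.BalabanUV.Beta.FP.PeriodicTransportSum (quotOf)
open Summit.QuantumFields.BalabanUV.Beta.FP.CompositeMinimiserDecay (abs_wH_le)
open Summit.QuantumFields.BalabanUV.Beta.GAN24.CoDressedColumnPairing (colH_coDressKBmAt_eq_sub_grad)
open Summit.QuantumFields.BalabanUV.Beta.GAN24.DressedLegEnvelope (abs_bmGaugeAt_le_of_blockwise)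
open Summit.QuantumFields.BalabanUV.Beta.GAN24.EnvelopeBlockSum (env_wobble env_le_exp_l1)

namespace Summit.QuantumFields.BalabanUV.Beta.D1BFx.PackedColumnEnvelope

variable {d : ℕ}

/-! ## §1 Dressing a column with a block-scale envelope costs one tree-gauge factor -/

/-- [folklore] `|e_κ|₁ = 1` on `ℤ^{d+1}`. -/
theorem l1_unitVec_eq_one (κ : Fin (d + 1)) : l1 (unitVec κ : Fin (d + 1) → ℤ) = 1 := by
  unfold B12Sec2to5.l1
  rw [Finset.sum_eq_single κ]
  · simp [AffineAveraging.unitVec]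
  · intro j _ hj
    simp [AffineAveraging.unitVec, hj]
  · intro h; exact absurd (Finset.mem_univ κ) h

/-- [folklore] **«G0-COL-ENV», GENERIC FORM: A CO-DRESSED COLUMN KEEPS A BLOCK-SCALE ENVELOPE, AT THE COST OF ONE TREE-GAUGE FACTOR.**  If the
`ℋ`-column of a packed kernel `K` at the coarse bond `(μ, y)` obeys `|colH K N μ y κ u| ≤ M·e^{−c‖⌊u∕N⌋ − y‖∞}` (`M, c ≥ 0`), then for every in-block root
`r` the column of the co-dressed kernel obeys `|colH (coDressKBmAt (toSite r) N K) N μ y κ u| ≤ M·(1 + 2(d+1)N·(1 + e^{c}))·e^{−c‖⌊u∕N⌋ − y‖∞}`: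
by `colH_coDressKBmAt_eq_sub_grad` the dressed column is `colH K − (χ(u + e_κ) − χ u)` with `χ` the block-mean-normalised rooted tree gauge of the
column, `|χ p| ≤ 2(d+1)N·M·e^{−c‖⌊p∕N⌋ − y‖∞}` (`abs_bmGaugeAt_le_of_blockwise`: the gauge at `p` reads `≤ (d+1)N` letters of the column inside the block
of `p`, where the envelope is constant), and the unit shift `u ↦ u + e_κ` moves the block label by at most one (`env_wobble`, factor `e^{c}`). -/
theorem abs_colH_coDressKBmAt_le_of_blockEnvelope {N : ℕ} (hN : 1 ≤ N) {r : Fin (d + 1) → ℕ} (hr : r ∈ box (d + 1) N)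
    {K : MKer (d + 1) (Fib d)} {μ : Fin (d + 1)} {y : Fin (d + 1) → ℤ} {M c : ℝ} (hM : 0 ≤ M) (hc : 0 ≤ c)
    (hK : ∀ κ u, |colH K N μ y κ u| ≤ M * Real.exp (-(c * supNorm (quo N u - y)))) (κ : Fin (d + 1)) (u : Fin (d + 1) → ℤ) :
    |colH (coDressKBmAt (toSite r) N K) N μ y κ u|
      ≤ M * (1 + 2 * (((d : ℝ) + 1) * N) * (1 + Real.exp c)) * Real.exp (-(c * supNorm (quo N u - y))) := by
  rw [colH_coDressKBmAt_eq_sub_grad hN hr K μ y κ u]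
  -- the block-mean-normalised rooted gauge of the column keeps the (block-constant) envelope
  have hχ : ∀ p, |bmGaugeAt (toSite r) (colH K N μ y) N p|
      ≤ 2 * ((((d : ℝ) + 1) * N) * (M * Real.exp (-(c * supNorm (quo N p - y))))) := fun p =>
    abs_bmGaugeAt_le_of_blockwise hN hr (A := colH K N μ y) (S := fun b => M * Real.exp (-(c * supNorm (b - y))))
      (fun κ z => hK κ z) p
  -- the shifted block label: `‖⌊(u + e_κ)∕N⌋ − y‖∞` exceeds `‖⌊u∕N⌋ − y‖∞` by at most `|e_κ|₁ = 1`
  have hEshift : Real.exp (-(c * supNorm (quo N (u + unitVec κ) - y))) ≤ Real.exp c * Real.exp (-(c * supNorm (quo N u - y))) := by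
    have h := env_wobble (d := d) hN hc y u (u + unitVec κ)
    rw [add_sub_cancel_left, l1_unitVec_eq_one, mul_one] at h
    exact h
  have h1 : |colH K N μ y κ u| ≤ M * Real.exp (-(c * supNorm (quo N u - y))) := hK κ u
  have h2 : |bmGaugeAt (toSite r) (colH K N μ y) N (u + unitVec κ)|
      ≤ 2 * ((((d : ℝ) + 1) * N) * (M * (Real.exp c * Real.exp (-(c * supNorm (quo N u - y)))))) :=
    (hχ (u + unitVec κ)).trans (by gcongr)
  have h3 : |bmGaugeAt (toSite r) (colH K N μ y) N u| ≤ 2 * ((((d : ℝ) + 1) * N) * (M * Real.exp (-(c * supNorm (quo N u - y))))) :=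
    hχ u
  calc |colH K N μ y κ u - (bmGaugeAt (toSite r) (colH K N μ y) N (u + unitVec κ) - bmGaugeAt (toSite r) (colH K N μ y) N u)|
      ≤ |colH K N μ y κ u| + (|bmGaugeAt (toSite r) (colH K N μ y) N (u + unitVec κ)| + |bmGaugeAt (toSite r) (colH K N μ y) N u|) :=
        (abs_sub _ _).trans (by gcongr; exact abs_sub _ _)
    _ ≤ M * Real.exp (-(c * supNorm (quo N u - y)))
        + (2 * ((((d : ℝ) + 1) * N) * (M * (Real.exp c * Real.exp (-(c * supNorm (quo N u - y))))))
          + 2 * ((((d : ℝ) + 1) * N) * (M * Real.exp (-(c * supNorm (quo N u - y)))))) :=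
        add_le_add h1 (add_le_add h2 h3)
    _ = M * (1 + 2 * (((d : ℝ) + 1) * N) * (1 + Real.exp c)) * Real.exp (-(c * supNorm (quo N u - y))) := by ring

/-! ## §2 The road's M-side pack: the gauged one-shot resolvent `G₀ = coDressKBmAt (toSite r) N (KInvStep d N 0)` -/

/-- [folklore] THE UNDRESSED ONE-SHOT COLUMN IS THE MINIMISER KERNEL: `colH (KInvStep d N 0) N μ y κ u = wH^{(N)} κ μ (u − N•y)`
(`KInvStep_zero_eq`, `KInv_inl_inr_coarse`), hence `abs_wH_le`'s unconditional block-scale envelope with the unit `N^{−(d+2)}`. -/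
theorem abs_colH_KInvStep_zero_le {N : ℕ} [NeZero N] (hN : 1 ≤ N) (μ : Fin (d + 1)) (y : Fin (d + 1) → ℤ) (κ : Fin (d + 1))
    (u : Fin (d + 1) → ℤ) :
    |colH (KInvStep (d := d) N 0) N μ y κ u|
      ≤ ((N : ℝ) ^ (d + 2))⁻¹ * (MG163 (d + 1) * periodConst (kappa163 (d + 1)) d)
          * Real.exp (-(kappa163 (d + 1) / ((d : ℝ) + 1) * supNorm (quo N u - y))) := by
  have h := abs_wH_le (d := d) N hN κ μ u y
  have hq : quotOf N u = quo N u := rfl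
  rw [hq] at h
  have hcol : colH (KInvStep (d := d) N 0) N μ y κ u = wH (N := N) κ μ (u - (N : ℤ) • y) := by
    unfold OneStepKernelFamily.colH
    rw [KInvStep_zero_eq, KInv_inl_inr_coarse]
  rw [hcol]
  exact h

/-- [folklore] **«G0-COL-ENV» ON THE BLOCK SCALE**: for every in-block root `r` (`1 ≤ N`),
`|colH (coDressKBmAt (toSite r) N (KInvStep d N 0)) N μ y κ u| ≤ N^{−(d+2)}·C_d·(1 + 2(d+1)N(1 + e^{c_d}))·e^{−c_d‖⌊u∕N⌋ − y‖∞}`,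
`C_d = MG163(d+1)·periodConst(κ₁₆₃(d+1), d)`, `c_d = κ₁₆₃(d+1)∕(d+1)`. -/
theorem abs_colH_G0_le_block {N : ℕ} [NeZero N] (hN : 1 ≤ N) {r : Fin (d + 1) → ℕ} (hr : r ∈ box (d + 1) N) (μ : Fin (d + 1))
    (y : Fin (d + 1) → ℤ) (κ : Fin (d + 1)) (u : Fin (d + 1) → ℤ) :
    |colH (coDressKBmAt (toSite r) N (KInvStep (d := d) N 0)) N μ y κ u|
      ≤ ((N : ℝ) ^ (d + 2))⁻¹ * (MG163 (d + 1) * periodConst (kappa163 (d + 1)) d)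
          * (1 + 2 * (((d : ℝ) + 1) * N) * (1 + Real.exp (kappa163 (d + 1) / ((d : ℝ) + 1))))
          * Real.exp (-(kappa163 (d + 1) / ((d : ℝ) + 1) * supNorm (quo N u - y))) := by
  have hM : 0 ≤ ((N : ℝ) ^ (d + 2))⁻¹ * (MG163 (d + 1) * periodConst (kappa163 (d + 1)) d) :=
    -- nonnegativity read off the undressed bound itself
    (mul_nonneg_iff_of_pos_right (Real.exp_pos _)).1 ((abs_nonneg _).trans (abs_colH_KInvStep_zero_le (d := d) hN μ y κ u))
  have hc : 0 ≤ kappa163 (d + 1) / ((d : ℝ) + 1) := div_nonneg (kappa163_pos (d + 1)).le (by positivity)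
  exact abs_colH_coDressKBmAt_le_of_blockEnvelope hN hr hM hc (fun κ' u' => abs_colH_KInvStep_zero_le (d := d) hN μ y κ' u') κ u

/-- [folklore] **«G0-COL-ENV», THE POWER DISPLAYED**: `N^{−(d+2)}·(1 + 2(d+1)N(1 + e^{c})) ≤ N^{−(d+1)}·(1 + 2(d+1)(1 + e^{c}))` for `N ≥ 1`, so
`|colH G₀ N μ y κ u| ≤ N^{−(d+1)}·C_d·(1 + 2(d+1)(1 + e^{c_d}))·e^{−c_d‖⌊u∕N⌋ − y‖∞}` — ONE power of `N` above the undressed column. -/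
theorem abs_colH_G0_le_block' {N : ℕ} [NeZero N] (hN : 1 ≤ N) {r : Fin (d + 1) → ℕ} (hr : r ∈ box (d + 1) N) (μ : Fin (d + 1))
    (y : Fin (d + 1) → ℤ) (κ : Fin (d + 1)) (u : Fin (d + 1) → ℤ) :
    |colH (coDressKBmAt (toSite r) N (KInvStep (d := d) N 0)) N μ y κ u|
      ≤ ((N : ℝ) ^ (d + 1))⁻¹ * ((MG163 (d + 1) * periodConst (kappa163 (d + 1)) d)
          * (1 + 2 * ((d : ℝ) + 1) * (1 + Real.exp (kappa163 (d + 1) / ((d : ℝ) + 1)))))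
          * Real.exp (-(kappa163 (d + 1) / ((d : ℝ) + 1) * supNorm (quo N u - y))) := by
  refine (abs_colH_G0_le_block (d := d) hN hr μ y κ u).trans ?_
  set C := MG163 (d + 1) * periodConst (kappa163 (d + 1)) d with hCdef
  set q := 1 + Real.exp (kappa163 (d + 1) / ((d : ℝ) + 1)) with hqdef
  have hN1 : (1 : ℝ) ≤ N := by exact_mod_cast hN
  have hN0 : (0 : ℝ) < N := by linarith
  have hC : 0 ≤ C := by
    -- `N^{−(d+2)}·C ≥ 0` read off the undressed bound, and `N^{−(d+2)} > 0`
    have h0 : 0 ≤ ((N : ℝ) ^ (d + 2))⁻¹ * C :=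
      (mul_nonneg_iff_of_pos_right (Real.exp_pos _)).1 ((abs_nonneg _).trans (abs_colH_KInvStep_zero_le (d := d) hN μ y κ u))
    exact (mul_nonneg_iff_of_pos_left (inv_pos.mpr (pow_pos hN0 _))).1 h0
  have hq : 0 ≤ q := by positivity
  have hE := (Real.exp_pos (-(kappa163 (d + 1) / ((d : ℝ) + 1) * supNorm (quo N u - y)))).le
  refine mul_le_mul_of_nonneg_right ?_ hE
  -- `N^{−(d+2)}·C·(1 + 2(d+1)N q) ≤ N^{−(d+1)}·C·(1 + 2(d+1) q)`
  have hpow : ((N : ℝ) ^ (d + 2))⁻¹ = ((N : ℝ) ^ (d + 1))⁻¹ * (N : ℝ)⁻¹ := by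
    rw [pow_succ, mul_inv]
  rw [hpow]
  have hinvN : (N : ℝ)⁻¹ ≤ 1 := inv_le_one_of_one_le₀ hN1
  have hinvN0 : 0 ≤ (N : ℝ)⁻¹ := inv_nonneg.mpr hN0.le
  have hP1 : 0 ≤ ((N : ℝ) ^ (d + 1))⁻¹ := inv_nonneg.mpr (pow_nonneg hN0.le _)
  have hkey : (N : ℝ)⁻¹ * (1 + 2 * (((d : ℝ) + 1) * N) * q) ≤ 1 + 2 * ((d : ℝ) + 1) * q := by
    have e : (N : ℝ)⁻¹ * (1 + 2 * (((d : ℝ) + 1) * N) * q) = (N : ℝ)⁻¹ + 2 * ((d : ℝ) + 1) * q := by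
      field_simp
    rw [e]
    linarith
  calc ((N : ℝ) ^ (d + 1))⁻¹ * (N : ℝ)⁻¹ * C * (1 + 2 * (((d : ℝ) + 1) * N) * q)
      = ((N : ℝ) ^ (d + 1))⁻¹ * C * ((N : ℝ)⁻¹ * (1 + 2 * (((d : ℝ) + 1) * N) * q)) := by ring
    _ ≤ ((N : ℝ) ^ (d + 1))⁻¹ * C * (1 + 2 * ((d : ℝ) + 1) * q) :=
        mul_le_mul_of_nonneg_left hkey (mul_nonneg hP1 hC)
    _ = ((N : ℝ) ^ (d + 1))⁻¹ * (C * (1 + 2 * ((d : ℝ) + 1) * q)) := by ring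

/-- [folklore] **«G0-COL-ENV» IN THE FINE `ℓ¹` CURRENCY** (the weight shape `hw` of `biLoc_wsum` ∕ `colH_weight` ∕ the jets' mass letters):
`|colH G₀ N μ y κ u| ≤ N^{−(d+1)}·C_d·(1 + 2(d+1)(1 + e^{c_d}))·e^{c_d}·e^{−(c_d∕((d+1)N))·|u − N•y|₁}` (`env_le_exp_l1`). -/
theorem abs_colH_G0_le_l1 {N : ℕ} [NeZero N] (hN : 1 ≤ N) {r : Fin (d + 1) → ℕ} (hr : r ∈ box (d + 1) N) (μ : Fin (d + 1))
    (y : Fin (d + 1) → ℤ) (κ : Fin (d + 1)) (u : Fin (d + 1) → ℤ) :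
    |colH (coDressKBmAt (toSite r) N (KInvStep (d := d) N 0)) N μ y κ u|
      ≤ ((N : ℝ) ^ (d + 1))⁻¹ * ((MG163 (d + 1) * periodConst (kappa163 (d + 1)) d)
          * (1 + 2 * ((d : ℝ) + 1) * (1 + Real.exp (kappa163 (d + 1) / ((d : ℝ) + 1)))) * Real.exp (kappa163 (d + 1) / ((d : ℝ) + 1)))
          * Real.exp (-(kappa163 (d + 1) / ((d : ℝ) + 1) / (((d : ℝ) + 1) * N)) * l1 (u - (N : ℤ) • y)) := by
  refine (abs_colH_G0_le_block' (d := d) hN hr μ y κ u).trans ?_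
  have hc : 0 ≤ kappa163 (d + 1) / ((d : ℝ) + 1) := div_nonneg (kappa163_pos (d + 1)).le (by positivity)
  have h := env_le_exp_l1 (d := d) hN hc y u
  have hN0 : (0 : ℝ) < N := by exact_mod_cast hN
  have hP1 : 0 ≤ ((N : ℝ) ^ (d + 1))⁻¹ := inv_nonneg.mpr (pow_nonneg hN0.le _)
  have hC : 0 ≤ (MG163 (d + 1) * periodConst (kappa163 (d + 1)) d)
      * (1 + 2 * ((d : ℝ) + 1) * (1 + Real.exp (kappa163 (d + 1) / ((d : ℝ) + 1)))) := by
    -- same sign read-off, now through `abs_colH_G0_le_block'` at `u`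
    have h0 := (mul_nonneg_iff_of_pos_right (Real.exp_pos _)).1
      ((abs_nonneg _).trans (abs_colH_G0_le_block' (d := d) hN hr μ y κ u))
    exact (mul_nonneg_iff_of_pos_left (inv_pos.mpr (pow_pos hN0 _))).1 h0
  calc ((N : ℝ) ^ (d + 1))⁻¹ * ((MG163 (d + 1) * periodConst (kappa163 (d + 1)) d)
          * (1 + 2 * ((d : ℝ) + 1) * (1 + Real.exp (kappa163 (d + 1) / ((d : ℝ) + 1)))))
          * Real.exp (-(kappa163 (d + 1) / ((d : ℝ) + 1) * supNorm (quo N u - y)))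
      ≤ ((N : ℝ) ^ (d + 1))⁻¹ * ((MG163 (d + 1) * periodConst (kappa163 (d + 1)) d)
          * (1 + 2 * ((d : ℝ) + 1) * (1 + Real.exp (kappa163 (d + 1) / ((d : ℝ) + 1)))))
          * (Real.exp (kappa163 (d + 1) / ((d : ℝ) + 1))
            * Real.exp (-(kappa163 (d + 1) / ((d : ℝ) + 1) / (((d : ℝ) + 1) * N)) * l1 (u - (N : ℤ) • y))) :=
        mul_le_mul_of_nonneg_left h (mul_nonneg hP1 hC)
    _ = _ := by ring

/-! ## §3 `d = 3`: the road's M-side packed weights `colH G₀ n`, `n = m + 1`, in the weight shape of the (II) rows -/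

/-- [folklore] **«G0-COL-ENV» FOR THE ROAD** (`d = 3`, block side `n = m + 1`, in-block root `r ∈ box 4 n`, ANY coarse bond `(μ, y)`, ANY fine direction `κ`):
`∀ u, |colH (coDressKBmAt (toSite r) n (KInvStep 3 n 0)) n μ y κ u| ≤ (n⁴)⁻¹·(C₄·(1 + 8(1 + e^{κ′}))·e^{κ′})·e^{−(κ′∕(4n))·|u − n•y|₁}`,
`C₄ = MG163 4·periodConst (kappa163 4) 3`, `κ′ = kappa163 4 ∕ 4` — THE LOCATED COUNT `n⁻⁴`, UNCONDITIONAL. -/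
theorem abs_colH_G₀_road_le (m : ℕ) {r : Fin (3 + 1) → ℕ} (hr : r ∈ box (3 + 1) (m + 1)) (μ : Fin (3 + 1)) (y : Fin (3 + 1) → ℤ)
    (κ : Fin (3 + 1)) :
    ∀ u : Fin (3 + 1) → ℤ, |colH (coDressKBmAt (toSite r) (m + 1) (KInvStep (d := 3) (m + 1) 0)) (m + 1) μ y κ u|
      ≤ ((((m + 1 : ℕ) : ℝ) ^ 4)⁻¹ * ((MG163 4 * periodConst (kappa163 4) 3)
          * (1 + 8 * (1 + Real.exp (kappa163 4 / 4))) * Real.exp (kappa163 4 / 4)))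
        * Real.exp (-(kappa163 4 / 4 / (4 * ((m + 1 : ℕ) : ℝ))) * l1 (u - ((m + 1 : ℕ) : ℤ) • y)) := by
  intro u
  have h := abs_colH_G0_le_l1 (d := 3) (N := m + 1) (Nat.le_add_left 1 m) hr μ y κ u
  have e3 : ((3 : ℕ) : ℝ) + 1 = 4 := by norm_num
  simp only [e3] at h
  have e8 : (2 : ℝ) * 4 = 8 := by norm_num
  rw [e8] at h
  exact h

/-- [folklore] The road's weight constant is nonnegative (for the `hC` slots of `biLoc_wsum`-type lemmas). -/
theorem colH_G₀_road_weight_nonneg (m : ℕ) :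
    0 ≤ ((((m + 1 : ℕ) : ℝ) ^ 4)⁻¹ * ((MG163 4 * periodConst (kappa163 4) 3)
          * (1 + 8 * (1 + Real.exp (kappa163 4 / 4))) * Real.exp (kappa163 4 / 4))) := by
  -- read off the bound itself at the block root `r = 0` and the coarse bond `(0, 0)`
  have hr : (fun _ : Fin (3 + 1) => (0 : ℕ)) ∈ box (3 + 1) (m + 1) :=
    Fintype.mem_piFinset.2 fun _ => Finset.mem_range.2 (Nat.succ_pos m)
  have h := abs_colH_G₀_road_le m hr 0 0 0 0
  exact (mul_nonneg_iff_of_pos_right (Real.exp_pos _)).1 ((abs_nonneg _).trans h)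

end Summit.QuantumFields.BalabanUV.Beta.D1BFx.PackedColumnEnvelope

end
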